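import Mathlib

/-!
# `UpperOffV0HSYPlus` (stmt-BirchSwinnertonDyer-19804), p ≡ 7 (mod 9): algebraic CERTIFICATE for the memo
# `MInfinityAtThree-g44.md` (ideator bsd-idea-20 g44; publish-only, W-79)

Mathlib-only shadows of the elementary steps used in the memo (R7-A / crux idea
`Ideas/m-infinity-one-at-three.md`, K1 «m_∞ ≥ 1» ⟸ `stub_levelFixingSeven`):

* §1 residues: at `p ≡ 7 (mod 9)` the minimal coefficient `16p²` of `E_p : y² = x³ + 16p²` at the place
  above `3` is `≡ 1 (mod 9)` and `2p² ≡ 8 ≡ −1 (mod 9)` (both cube classes; cubes mod 9 are `{0, 1, 8}`), while at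
  `p ≡ 4 (mod 9)` they are `≡ 4, 5` (non-cubes) — the arithmetic behind «`E_p[2] ⊂ E_p(ℚ₃(ζ₃))` iff
  `p ≡ 7 (9)`», Kodaira `I₀*`, `c_{𝔭₃} = 4` (cf. tree `pow_three_ne_two_mul_sq_adicCompletion_of_three_mem`,
  which is stated for `p % 9 = 4` only, and the card's PARI data kit j332864);
* §2 the spare bit: `2^{M+1} ∣ ℓ + 1 ⇒ (ℓ+1)/2^M` even (the unramified part `u_n` of the localisation vanishes);
* §3 the halving algebra: for an additive map `comp` into a group killed by `2` and an endomorphism `φ`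
  with `comp ∘ φ = comp`, `comp (Q + φ Q) = 0` (CLAIM L), `comp` kills `2^M`-multiples (`M ≥ 1`), and a
  `φ`-fixed family sums over a `φ`-paired transversal to `2 •` the half sum (ROAD F: `P_n = 2 • Q_n`);
* §4 parity of `[K[9p] : K] = 3(p − 1)`.

HONEST LABEL: these are shadows of the memo's algebra, not the arithmetic (no CM points, no Galois
cohomology); nothing is asserted on 19804; no stub is closed; `X12.CMAtTwo` NOT proved; BSD not claimed for
any curve; no summit statement is proved by this seat.
-/

-- every Summits module is named `Summit.<Summit>.<Problem>…`: the duplicated component is by design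
set_option linter.dupNamespace false
set_option autoImplicit false

namespace Summit.BirchSwinnertonDyer.BirchSwinnertonDyer.Cruxes.UpperOffV0HSYPlus.MInfinityAtThreeCert

/-! ## §1 Residues mod 9 -/

/-- Cubes modulo `9` are `0, 1, 8`. -/
theorem cube_mod_nine (x : ZMod 9) : x ^ 3 = 0 ∨ x ^ 3 = 1 ∨ x ^ 3 = 8 := by
  revert x; decide

/-- `432 = 3³·16`, `3 ∤ 16`: `y² = x³ − 432p²` rescales by `u = √−3` (`u⁶ = −27`) to `y² = x³ + 16p²`,
minimal at the place above `3` of `ℚ(√−3)` with `v_π(Δ) = v_π(−432·(16p²)²) = 6` (`I₀*` needs `v(Δ) = 6`,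
`f = v(Δ) − 4 = 2`). -/
theorem disc_data : (432 : ℕ) = 3 ^ 3 * 16 ∧ ¬ 3 ∣ 16 ∧ -432 / (-27 : ℤ) = 16 := by decide

/-- At `p ≡ 7 (mod 9)`: `p² ≡ 4`, `16p² ≡ 1`, `2p² ≡ 8 ≡ −1 (mod 9)` — cube classes (`1 + 9ℤ₃ ⊂ ℤ₃^{×3}`). -/
theorem residues_seven {p : ℕ} (h : p % 9 = 7) :
    p ^ 2 % 9 = 4 ∧ 16 * p ^ 2 % 9 = 1 ∧ 2 * p ^ 2 % 9 = 8 := by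
  have h2 : p ^ 2 % 9 = 4 := by rw [Nat.pow_mod, h]
  refine ⟨h2, ?_, ?_⟩
  · rw [Nat.mul_mod, h2]
  · rw [Nat.mul_mod, h2]

/-- At `p ≡ 4 (mod 9)`: `p² ≡ 7`, `16p² ≡ 4`, `2p² ≡ 5 (mod 9)` — NOT cube classes (no `K_v`-rational
`2`-torsion, Kodaira `IV`, `c = 1`; the tree's `pow_three_ne_two_mul_sq_adicCompletion_of_three_mem`). -/
theorem residues_four {p : ℕ} (h : p % 9 = 4) :
    p ^ 2 % 9 = 7 ∧ 16 * p ^ 2 % 9 = 4 ∧ 2 * p ^ 2 % 9 = 5 := by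
  have h2 : p ^ 2 % 9 = 7 := by rw [Nat.pow_mod, h]
  refine ⟨h2, ?_, ?_⟩
  · rw [Nat.mul_mod, h2]
  · rw [Nat.mul_mod, h2]

/-- `4` and `5` are not cubes mod `9`; `1` and `8` are. -/
theorem cube_classes : (¬ ∃ x : ZMod 9, x ^ 3 = 4) ∧ (¬ ∃ x : ZMod 9, x ^ 3 = 5) ∧
    (∃ x : ZMod 9, x ^ 3 = 1) ∧ (∃ x : ZMod 9, x ^ 3 = 8) := by decide

/-! ## §2 The spare bit -/

/-- If `2^{M+1} ∣ ℓ + 1` then `(ℓ + 1)/2^M` is even: with one spare bit the coefficients `(ℓ+1)/2^M` of the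
unramified part of `loc_v c(n)` are even, hence vanish on a component group killed by `2`. -/
theorem even_div_of_pow_succ_dvd {ℓ M : ℕ} (h : 2 ^ (M + 1) ∣ ℓ + 1) : Even ((ℓ + 1) / 2 ^ M) := by
  obtain ⟨k, hk⟩ := h
  rw [hk, pow_succ, mul_assoc, Nat.mul_div_cancel_left _ (by positivity)]
  exact even_two_mul k

/-! ## §3 The halving algebra (CLAIM L and ROAD F) -/

section Halving

variable {A V : Type*} [AddCommGroup A] [AddCommGroup V]

/-- **CLAIM L, algebraic core.** `comp` additive into a group killed by `2`, `φ` an endomorphism with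
`comp ∘ φ = comp` (the decomposition involution acts trivially on `E(L)/E₀(L) ≅ E[2] ⊂ E(K_v)`):
`comp (Q + φ Q) = 0` — the component of `P_n = Q + φQ` vanishes. -/
theorem comp_add_phi_eq_zero (comp : A →+ V) (φ : A →+ A) (hφ : ∀ a, comp (φ a) = comp a)
    (h2 : ∀ v : V, v + v = 0) (Q : A) : comp (Q + φ Q) = 0 := by
  rw [map_add, hφ, h2]

/-- `comp` kills `2^M • a` for `M ≥ 1` (so `comp_w(P_n)` does not depend on the transversal: two
transversals give `P_n`'s differing by an element of `2^{M(n)} E(K_n)`). -/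
theorem comp_pow_nsmul_eq_zero (comp : A →+ V) (h2 : ∀ v : V, v + v = 0) {M : ℕ} (hM : 1 ≤ M)
    (a : A) : comp (2 ^ M • a) = 0 := by
  have hE : Even (2 ^ M) := Nat.even_pow.mpr ⟨even_two, by omega⟩
  obtain ⟨k, hk⟩ := hE
  rw [map_nsmul, hk, add_nsmul, h2]

/-- Transversal independence, algebraic core: if `P' = P + 2^M • d` then `comp P' = comp P`. -/
theorem comp_eq_of_eq_add_pow_nsmul (comp : A →+ V) (h2 : ∀ v : V, v + v = 0) {M : ℕ} (hM : 1 ≤ M)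
    {P P' d : A} (h : P' = P + 2 ^ M • d) : comp P' = comp P := by
  rw [h, map_add, comp_pow_nsmul_eq_zero comp h2 hM, add_zero]

/-- **ROAD F, algebraic core.** Over a `φ`-paired transversal `S = S₀ ⊔ S₀φ` the full sum is
`Σ_{S₀} (f i + φ (f i))`; if `φ` fixes each `f i` (TOWER FIXING `stub_levelFixingSeven`: `φ (s D_n y_n) =
s D_n (φ y_n) = s D_n y_n`) it equals `2 •` the half sum `Q_n = Σ_{S₀} f i`. -/
theorem sum_pair_eq_two_nsmul {ι : Type*} (S₀ : Finset ι) (f : ι → A) (φ : A →+ A)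
    (hfix : ∀ i ∈ S₀, φ (f i) = f i) :
    ∑ i ∈ S₀, (f i + φ (f i)) = 2 • ∑ i ∈ S₀, f i := by
  rw [two_nsmul, ← Finset.sum_add_distrib]
  exact Finset.sum_congr rfl (fun i hi => by rw [hfix i hi])

/-- Without any fixing hypothesis the paired sum still has component zero (CLAIM L for the full `P_n`):
`comp (Σ_{S₀} (f i + φ (f i))) = 0`. -/
theorem comp_sum_pair_eq_zero {ι : Type*} (S₀ : Finset ι) (f : ι → A) (comp : A →+ V) (φ : A →+ A)
    (hφ : ∀ a, comp (φ a) = comp a) (h2 : ∀ v : V, v + v = 0) :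
    comp (∑ i ∈ S₀, (f i + φ (f i))) = 0 := by
  rw [map_sum]
  exact Finset.sum_eq_zero (fun i _ => comp_add_phi_eq_zero comp φ hφ h2 (f i))

/-- `φ` commutes with the operators: if `φ` commutes with an endomorphism `D` (all of `𝒢_n` is abelian) and
fixes `y`, it fixes `D y`. -/
theorem phi_fix_of_commute (φ D : A →+ A) (hcomm : ∀ a, φ (D a) = D (φ a)) {y : A} (hy : φ y = y) :
    φ (D y) = D y := by
  rw [hcomm, hy]

end Halving

/-! ## §4 Degrees -/

/-- `[K[9p] : K] = 3(p − 1)` is even for a prime `p ≡ 7 (mod 9)` (so `⟨s⟩` of order `2` has a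
half-transversal `S̄₀` of size `3(p−1)/2` in `Gal(K[9p]/K)`). -/
theorem even_degree {p : ℕ} (hp : p.Prime) (h9 : p % 9 = 7) : Even (3 * (p - 1)) := by
  have hp2 : p ≠ 2 := by rintro rfl; norm_num at h9
  exact (hp.even_sub_one hp2).mul_left 3

/-- The decomposition group at the place above `3` in `K[9pn]/K` has order `18 = 9·2` (`e = 9`, `f = 2`):
even, so it contains an involution; `9` is odd, so an involution is never in the inertia subgroup's
complement issue — recorded as the arithmetic `18 = 9 * 2 ∧ Odd 9`. -/
theorem decomposition_order : (18 : ℕ) = 9 * 2 ∧ Odd (9 : ℕ) ∧ Even (18 : ℕ) := by decide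

end Summit.BirchSwinnertonDyer.BirchSwinnertonDyer.Cruxes.UpperOffV0HSYPlus.MInfinityAtThreeCert
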